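import Literature.NumberTheory.EllipticCurves.RootNumberAtkinLehnerProofs
import Literature.NumberTheory.EllipticCurves.AtkinLehnerProductProofs
import Literature.NumberTheory.EllipticCurves.LFunctionPrimeCoeff
import Literature.NumberTheory.EllipticCurves.BSDRootNumberPrimesEquivProofs
import HarnessLib

/-!
# Kellock–Dokchitser's Remark 2.2 at the primes `p ∥ N_E` is a theorem: `λ(p)(f_E) = w_p(E)`;
the root number of a semistable `E / ℚ` from modularity and Atkin–Lehner theory (proofs)

A `…Proofs` sibling (theorems only) of `RootNumberAtkinLehner`, whose named fact
`WeierstrassCurve.atkinLehnerEigenvalueAt_eq_localRootNumberAt` (F1; Kellock–Dokchitser 2023,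
Rem. 2.2: for the newform `f` of an elliptic `W / ℚ` and `p ∣ N_W`, the Atkin–Lehner eigenvalue
`λ(Q_p)(f)` equals Rohrlich's local root number `w_p(E)`) is deep only at the additive primes. Here
the **multiplicative primes are settled unconditionally**:

* `atkinLehnerEigenvalueAt_eq_localRootNumberAt_of_not_sq_dvd` — for `p ∣ N_W`, `p² ∤ N_W`:
  `λ(p)(f) = w_p(E)`. Proof: `λ(p) = −a_p(f)` and `λ(p) = ±1` (Knapp 1993, Thm. 9.27 in weight `2`,
  `IsNewform0.atkinLehnerEigenvalueAt_eq_neg_coeff_of_not_dvd` and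
  `IsNewform0.exists_atkinLehnerInvolutionAt_eq_smul_of_not_dvd` of `AtkinLehnerInvolutionsProofs`);
  `a_p(f) = a_p(E)` (`IsNewformOf`) is the linear coefficient of the inverted local factor of
  Mathlib's `WeierstrassCurve.LFunction` at the place `v'` of `𝓞 ℚ` over `p`
  (`LFunction_apply_primesEquiv`), i.e. `1`, `−1`, `0` for split multiplicative, non-split
  multiplicative, additive reduction of the chosen minimal model at `v'`
  (`coeff_one_localPowerSeries_of_…`; Silverman, *AEC*, §C.16); the reduction at `v'` is bad since
  `p ∣ N_W` (`not_hasGoodReductionAt_ringOfIntegers_of_dvd_conductorNorm`: Ogg–Saito `f_v = 0 ↔` good,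
  `conductorExponent_eq_zero_iff_holds`, and the two `ℚ_v ≃ ℚ_[p]` bridges of the tree), and not
  additive (else `λ(p) = −a_p = 0 ≠ ±1`), hence multiplicative with `a_p = 1, w_p = −1` (split) or
  `a_p = −1, w_p = +1` (non-split) — Rohrlich 1993, Prop. 2(ii); Kellock–Dokchitser 2023,
  Thm. 2.3(iii),(iv); the local root numbers at the places of `ℤ` and of `𝓞 ℚ` over `p` agree, both
  being `w(E/ℚ_p)` (`localRootNumberAt_eq_localRootNumber_padic` of `BSDRootNumberPrimesEquivProofs`).
  This is also an end-to-end check of the sign conventions of the tree (Fricke normalisation,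
  `L`-function, Rohrlich's case list) against each other.
* `atkinLehnerEigenvalueAt_eq_localRootNumberAt_of_squarefree` — hence **F1 holds outright for a
  semistable `W`** (squarefree conductor);
* `rootNumber_eq_algebraicRootNumber_of_squarefree` — **the root number formula
  `w(E) = −∏_p w_p(E)` of a semistable `E / ℚ`** (`W.rootNumber_eq_algebraicRootNumber`; here
  `(−1)^{1+s}`, `s` = number of split multiplicative primes, Kellock–Dokchitser 2023, Cor. 2.5)
  **from the Modularity Theorem (`exists_isNewformOf`) alone**, Atkin–Lehner's `ε(f) = ∏ λ(p)` at
  squarefree level being a theorem (`AtkinLehnerProductProofs`); also from BCDT Thm. B + CDT Thm. 7.2.4;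
* `rootNumber_eq_algebraicRootNumber_of_exists_atkinLehnerInvolutionAt_eq_smul` — in general, the fact
  from modularity, F1 (Kellock–Dokchitser Rem. 2.2) and F3 = Knapp Thm. 9.27(b) (a newform is a
  `w_{Q_p}`-eigenvector), Thm. 9.27(c) being derived from (b) in `AtkinLehnerProductProofs`.

## References

* [KellockDokchitser2023] L. Cowland Kellock, V. Dokchitser, Bull. LMS 55 (2023), Rem. 2.2,
  Thm. 2.3, Cor. 2.5 (PDF pp. 7–8 of `paper:arxiv-2303.07883`).
* [Knapp1993] A. W. Knapp, *Elliptic curves* (1993), Thm. 9.27 (PDF pp. 217–218).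
* [SilvermanAEC2009] J. H. Silverman, *The Arithmetic of Elliptic Curves*, 2nd ed., §C.16
  (definition of `L_v(T)`, PDF p. 390), VII.5 Prop. 5.1.
* [Rohrlich1993Compositio] D. Rohrlich, Compositio Math. 87 (1993), Prop. 2(ii).
* [Rohrlich1994CRM] D. Rohrlich, CRM Proc. Lecture Notes 4 (1994), §19 (not held).
-/

noncomputable section

open scoped MatrixGroups

open CongruenceSubgroup Literature.NumberTheory.EllipticCurves.ModularForms IsDedekindDomain
  Literature.NumberTheory.Automorphic.BCDT Rat.HeightOneSpectrum NumberField

namespace WeierstrassCurve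

/-! ### The linear coefficient of the inverted local factor at the bad places -/

section LocalField

variable (R : Type*) [CommRing R] [IsDomain R] [IsDiscreteValuationRing R] {K : Type*}
  [Field K] [Algebra R K] [IsFractionRing R K] (X : WeierstrassCurve K)

open Polynomial in
/-- At a place of split multiplicative reduction the local factor is `L_v(T) = 1 − T`, so the linear
coefficient of `1 / L_v(T)` is `1` (Silverman, *AEC*, §C.16, definition of `L_v(T)`; Mathlib's
`localPolynomial`). [cite: SilvermanAEC2009, §C.16 (definition of L_v(T)), PDF p. 390] -/
theorem coeff_one_localPowerSeries_of_hasSplitMultiplicativeReduction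
    (h : (X.minimal R).HasSplitMultiplicativeReduction R) :
    PowerSeries.coeff 1 (X.localPowerSeries R) = 1 := by
  have hg : ¬ (X.minimal R).HasGoodReduction R :=
    h.toHasMultiplicativeReduction.not_hasGoodReduction R
  rw [localPowerSeries, PowerSeries.coeff_one_invOfUnit_one, localPolynomial, if_neg hg, if_pos h]
  simp

open Polynomial in
/-- At a place of non-split multiplicative reduction the local factor is `L_v(T) = 1 + T`, so the
linear coefficient of `1 / L_v(T)` is `−1` (Silverman, *AEC*, §C.16). [cite: SilvermanAEC2009, §C.16 (definition of L_v(T)), PDF p. 390] -/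
theorem coeff_one_localPowerSeries_of_hasMultiplicativeReduction_of_not_split
    (h : (X.minimal R).HasMultiplicativeReduction R)
    (hs : ¬ (X.minimal R).HasSplitMultiplicativeReduction R) :
    PowerSeries.coeff 1 (X.localPowerSeries R) = -1 := by
  have hg : ¬ (X.minimal R).HasGoodReduction R := h.not_hasGoodReduction R
  rw [localPowerSeries, PowerSeries.coeff_one_invOfUnit_one, localPolynomial, if_neg hg, if_neg hs,
    if_pos h]
  simp

open Polynomial in
/-- At a place of additive reduction the local factor is `L_v(T) = 1`, so the linear coefficient of
`1 / L_v(T)` is `0` (Silverman, *AEC*, §C.16). [cite: SilvermanAEC2009, §C.16 (definition of L_v(T)), PDF p. 390] -/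
theorem coeff_one_localPowerSeries_of_hasAdditiveReduction
    (h : (X.minimal R).HasAdditiveReduction R) :
    PowerSeries.coeff 1 (X.localPowerSeries R) = 0 := by
  have hg : ¬ (X.minimal R).HasGoodReduction R := h.not_hasGoodReduction R
  have hm : ¬ (X.minimal R).HasMultiplicativeReduction R := h.not_hasMultiplicativeReduction R
  have hs : ¬ (X.minimal R).HasSplitMultiplicativeReduction R := fun hs ↦
    hm hs.toHasMultiplicativeReduction
  rw [localPowerSeries, PowerSeries.coeff_one_invOfUnit_one, localPolynomial, if_neg hg, if_neg hs,
    if_neg hm]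
  simp

end LocalField

/-! ### `a_p(E)` at a bad prime `p` -/

section Rat

variable (W : WeierstrassCurve ℚ)

/-- **The `p`-th coefficient of `L(E/ℚ, s)` is the linear coefficient of the inverted local factor at
the place over `p`**: only the place `v` of `𝓞 ℚ` over `p` has residue field of cardinality `p`
(Silverman, *AEC*, §C.16 and Exercise 8.19(a); `LFunction_apply_prime` of `LFunctionPrimeCoeff`).
[cite: SilvermanAEC2009, Exercise 8.19(a) (p. 230) and §C.16 (PDF p. 390)] -/
theorem LFunction_apply_primesEquiv (v : HeightOneSpectrum (𝓞 ℚ)) :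
    W.LFunction (primesEquiv v) = PowerSeries.coeff 1
      ((W.baseChange (v.adicCompletion ℚ)).localPowerSeries (v.adicCompletionIntegers ℚ)) := by
  rw [W.LFunction_apply_prime (primesEquiv v).2, finsum_eq_single _ v fun w hw ↦ ?_]
  · rw [localEulerFactor_apply_prime _ _ (primesEquiv v).2,
      if_pos (natCard_residueField_adicCompletionIntegers v)]
  · rw [localEulerFactor_apply_prime _ _ (primesEquiv v).2, if_neg]
    rw [natCard_residueField_adicCompletionIntegers, ← Subtype.ext_iff]
    exact fun h ↦ hw (primesEquiv.injective h)

/-- `a_p(E) = 1` at a prime of split multiplicative reduction (Silverman, *AEC*, §C.16: local factor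
`1 − T`; here `p = primesEquiv v` and the reduction type is that of the chosen minimal model at the
place `v` of `𝓞 ℚ`). [cite: SilvermanAEC2009, §C.16 (definition of L_v(T)), PDF p. 390] -/
theorem LFunction_apply_primesEquiv_of_hasSplitMultiplicativeReductionAt
    {v : HeightOneSpectrum (𝓞 ℚ)} (h : W.HasSplitMultiplicativeReductionAt v) :
    W.LFunction (primesEquiv v) = 1 := by
  rw [LFunction_apply_primesEquiv]
  exact coeff_one_localPowerSeries_of_hasSplitMultiplicativeReduction _ _ h

/-- `a_p(E) = −1` at a prime of non-split multiplicative reduction (Silverman, *AEC*, §C.16: local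
factor `1 + T`). [cite: SilvermanAEC2009, §C.16 (definition of L_v(T)), PDF p. 390] -/
theorem LFunction_apply_primesEquiv_of_hasMultiplicativeReductionAt_of_not_split
    {v : HeightOneSpectrum (𝓞 ℚ)} (h : W.HasMultiplicativeReductionAt v)
    (hs : ¬ W.HasSplitMultiplicativeReductionAt v) : W.LFunction (primesEquiv v) = -1 := by
  rw [LFunction_apply_primesEquiv]
  exact coeff_one_localPowerSeries_of_hasMultiplicativeReduction_of_not_split _ _ h hs

/-- `a_p(E) = 0` at a prime of additive reduction (Silverman, *AEC*, §C.16: local factor `1`).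
[cite: SilvermanAEC2009, §C.16 (definition of L_v(T)), PDF p. 390] -/
theorem LFunction_apply_primesEquiv_of_hasAdditiveReductionAt {v : HeightOneSpectrum (𝓞 ℚ)}
    (h : W.HasAdditiveReductionAt v) : W.LFunction (primesEquiv v) = 0 := by
  rw [LFunction_apply_primesEquiv]
  exact coeff_one_localPowerSeries_of_hasAdditiveReduction _ _ h

/-- Place-indexed versus prime-indexed local root numbers over any integer ring `R` of `ℚ` (`ℤ` or
`𝓞 ℚ`): `w_v(E) = w(E/ℚ_p)` for `v = primesEquiv.symm p` (the tree's
`localRootNumberAt_eq_localRootNumber_padic`, re-indexed by the prime; Rohrlich 1994, §19).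
[cite: Rohrlich1994CRM, §19] -/
theorem localRootNumberAt_primesEquiv_symm_eq {R : Type*} [CommRing R] [IsDedekindDomain R]
    [Algebra R ℚ] [IsFractionRing R ℚ] [IsIntegralClosure R ℤ ℚ] [W.IsElliptic] (p : Nat.Primes) :
    W.localRootNumberAt ((primesEquiv (R := R)).symm p) =
      (haveI := Fact.mk p.2; (W.baseChange ℚ_[p]).localRootNumber ℤ_[p]) := by
  obtain ⟨v, rfl⟩ := (primesEquiv (R := R)).surjective p
  rw [Equiv.symm_apply_apply]
  exact W.localRootNumberAt_eq_localRootNumber_padic v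

/-- The local root number at the place of `ℤ` under `p` equals that at the place of `𝓞 ℚ` under `p`
(both are `w(E/ℚ_p)`). [cite: Rohrlich1994CRM, §19] -/
theorem localRootNumberAt_primesEquiv_symm_int_eq_ringOfIntegers [W.IsElliptic] (p : Nat.Primes) :
    W.localRootNumberAt ((primesEquiv (R := ℤ)).symm p) =
      W.localRootNumberAt ((primesEquiv (R := 𝓞 ℚ)).symm p) := by
  rw [localRootNumberAt_primesEquiv_symm_eq, localRootNumberAt_primesEquiv_symm_eq]

/-- A prime dividing the conductor is a prime of bad reduction, at the place of `𝓞 ℚ` over it: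
`p ∣ N_W` gives `f_v ≠ 0` at the place `v` of `ℤ` under `p` (`factorization_conductorNorm_holds`),
hence bad reduction there (`conductorExponent_eq_zero_iff_holds`, Silverman ATAEC IV.10.2(a)),
hence over `ℚ_[p]` and at the place of `𝓞 ℚ` (`hasGoodReductionAtPrime_iff_hasGoodReductionAt_holds`,
`hasGoodReductionAtPrime_primesEquiv_iff_holds`; Silverman AEC VII.5.1(a)).
[cite: Silverman1994, IV.10.2(a)] -/
theorem not_hasGoodReductionAt_ringOfIntegers_of_dvd_conductorNorm [W.IsElliptic] (p : Nat.Primes)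
    (hp : (p : ℕ) ∣ W.conductorNorm ℤ) :
    ¬ W.HasGoodReductionAt ((primesEquiv (R := 𝓞 ℚ)).symm p) := by
  intro hgood
  haveI := Fact.mk p.2
  have hv : ((primesEquiv ((primesEquiv (R := 𝓞 ℚ)).symm p) : Nat.Primes) : ℕ) = p := by
    rw [Equiv.apply_symm_apply]
  have hprime : W.HasGoodReductionAtPrime p :=
    (hasGoodReductionAtPrime_primesEquiv_iff_holds W _ p hv).mpr hgood
  have hgoodZ : W.HasGoodReductionAt ((primesEquiv (R := ℤ)).symm p) :=
    (W.hasGoodReductionAtPrime_iff_hasGoodReductionAt_holds p).mp hprime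
  have h0 : W.conductorExponent ((primesEquiv (R := ℤ)).symm p) = 0 :=
    (conductorExponent_eq_zero_iff_holds _ W).mpr hgoodZ
  have hfac := factorization_conductorNorm_holds W ((primesEquiv (R := ℤ)).symm p)
  rw [h0] at hfac
  have hgen : natGenerator ((primesEquiv (R := ℤ)).symm p) = p :=
    congrArg (fun q : Nat.Primes ↦ (q : ℕ)) ((primesEquiv (R := ℤ)).apply_symm_apply p)
  rw [hgen] at hfac
  have hmem : (p : ℕ) ∈ (W.conductorNorm ℤ).primeFactors :=
    Nat.mem_primeFactors.mpr ⟨p.2, hp, (W.conductorNorm_pos_holds).ne'⟩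
  rw [← Nat.support_factorization, Finsupp.mem_support_iff] at hmem
  exact hmem hfac

/-- **Kellock–Dokchitser's Remark 2.2 at a prime `p ∥ N_E`, proved.** For an elliptic `W / ℚ`,
`f ∈ S₂(Γ₀(N_W))` its newform, and a prime `p` with `p ∣ N_W`, `p² ∤ N_W`:
`λ(p)(f) = w_p(E)`. Indeed `λ(p) = −a_p(f)` (Knapp 1993, Thm. 9.27 with `k = 2`;
`IsNewform0.atkinLehnerEigenvalueAt_eq_neg_coeff_of_not_dvd`) and `λ(p) = ±1` (`w_p² = 1`), while
`a_p(f) = a_p(E)` (modularity datum `IsNewformOf`) is the linear coefficient of the inverted local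
factor at the place over `p` (`LFunction_apply_primesEquiv`): the reduction there is bad
(`p ∣ N_W`), not additive (else `a_p = 0 ≠ ∓1`), hence multiplicative, with `a_p = 1`, `w_p = −1` if
split and `a_p = −1`, `w_p = +1` if non-split (Rohrlich 1993, Prop. 2(ii); Kellock–Dokchitser 2023,
Thm. 2.3(iii),(iv)). No hypothesis at `2, 3` is needed (multiplicative reduction).
[cite: KellockDokchitser2023, Rem. 2.2 and Thm. 2.3] [cite: Knapp1993, Thm. 9.27] -/
theorem atkinLehnerEigenvalueAt_eq_localRootNumberAt_of_not_sq_dvd [W.IsElliptic]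
    [NeZero (W.conductorNorm ℤ)] {f : CuspForm (Gamma0 (W.conductorNorm ℤ)) 2} (hf : IsNewformOf W f)
    (p : Nat.Primes) (hp : (p : ℕ) ∣ W.conductorNorm ℤ) (hp2 : ¬ (p : ℕ) ^ 2 ∣ W.conductorNorm ℤ) :
    atkinLehnerEigenvalueAt f p =
      (W.localRootNumberAt ((primesEquiv (R := ℤ)).symm p) : ℂ) := by
  haveI := Fact.mk p.2
  -- `N_W = p M`, `p ∤ M`
  obtain ⟨M, hN⟩ := hp
  have hpM : ¬ (p : ℕ) ∣ M := fun ⟨M', hM'⟩ ↦ hp2 ⟨M', by rw [hN, hM']; ring⟩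
  -- modular side: `λ(p) = -a_p(f) = -a_p(E)` and `λ(p) = ±1`
  have hlam : atkinLehnerEigenvalueAt f p = -cuspCoeff f p :=
    hf.1.atkinLehnerEigenvalueAt_eq_neg_coeff_of_not_dvd p hN hpM
  have hap : cuspCoeff f p = (W.LFunction p : ℂ) := hf.2 p
  obtain ⟨ε, hε1, hε⟩ := hf.1.exists_atkinLehnerInvolutionAt_eq_smul_of_not_dvd p hN hpM
  have hf0 : f ≠ 0 := fun h0 ↦ hf.1.coe_ne_zero (by rw [h0]; rfl)
  have hlamε : atkinLehnerEigenvalueAt f p = ε := atkinLehnerEigenvalueAt_eq_of_eq_smul hf0 hε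
  -- curve side, at the place `v'` of `𝓞 ℚ` over `p`
  set v' : HeightOneSpectrum (𝓞 ℚ) := (primesEquiv (R := 𝓞 ℚ)).symm p with hv'
  have hpv' : primesEquiv v' = p := (primesEquiv (R := 𝓞 ℚ)).apply_symm_apply p
  rw [W.localRootNumberAt_primesEquiv_symm_int_eq_ringOfIntegers p, ← hv', hlam, hap, ← hpv']
  have hbad : ¬ W.HasGoodReductionAt v' :=
    W.not_hasGoodReductionAt_ringOfIntegers_of_dvd_conductorNorm p ⟨M, hN⟩
  rcases hasGoodReductionAt_or_hasMultiplicativeReductionAt_or_hasAdditiveReductionAt v' W with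
    hg | hm | ha
  · exact absurd hg hbad
  · by_cases hs : W.HasSplitMultiplicativeReductionAt v'
    · rw [W.LFunction_apply_primesEquiv_of_hasSplitMultiplicativeReductionAt hs,
        show W.localRootNumberAt v' = -1 from localRootNumber_of_hasSplitMultiplicativeReduction _ _ hs]
      push_cast
      ring
    · rw [W.LFunction_apply_primesEquiv_of_hasMultiplicativeReductionAt_of_not_split hm hs,
        show W.localRootNumberAt v' = 1 from localRootNumber_of_hasMultiplicativeReduction _ _ hm hs]
      push_cast
      ring
  · -- additive: `a_p = 0`, contradicting `λ(p) = -a_p = ±1`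
    exfalso
    have h0 : atkinLehnerEigenvalueAt f p = 0 := by
      rw [hlam, hap, ← hpv', W.LFunction_apply_primesEquiv_of_hasAdditiveReductionAt ha]
      push_cast
      ring
    rw [hlamε] at h0
    rcases hε1 with h1 | h1 <;> rw [h1] at h0 <;> norm_num at h0

/-- **Kellock–Dokchitser's Remark 2.2 for a semistable `E / ℚ`, proved**: if the conductor `N_W` is
squarefree (every `p ∣ N_W` has `p ∥ N_W`, i.e. `W` has multiplicative reduction at all bad places)
then the named fact `W.atkinLehnerEigenvalueAt_eq_localRootNumberAt` holds outright
(`atkinLehnerEigenvalueAt_eq_localRootNumberAt_of_not_sq_dvd` at each `p ∣ N_W`).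
[cite: KellockDokchitser2023, Rem. 2.2 and Cor. 2.5] -/
theorem atkinLehnerEigenvalueAt_eq_localRootNumberAt_of_squarefree
    (hsq : Squarefree (W.conductorNorm ℤ)) : W.atkinLehnerEigenvalueAt_eq_localRootNumberAt := by
  intro _ _ f hf p hp _
  refine W.atkinLehnerEigenvalueAt_eq_localRootNumberAt_of_not_sq_dvd hf p hp fun h2 ↦ ?_
  have := hsq p (by rw [← sq]; exact h2)
  exact p.2.ne_one (Nat.isUnit_iff.mp this)

/-- **The root number of a semistable elliptic curve over `ℚ` from the Modularity Theorem alone.**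
For `W / ℚ` elliptic with squarefree conductor, `w(E) = −∏_p w_p(E)` (the named fact
`W.rootNumber_eq_algebraicRootNumber`; here `= (−1)^{1+s}`, `s` the number of primes of split
multiplicative reduction, Kellock–Dokchitser 2023, Cor. 2.5) follows from the Modularity Theorem,
Version `L` (`exists_isNewformOf`, BCDT 2001 Thm. A — for semistable curves Wiles 1995 and
Taylor–Wiles 1995) **and nothing else**: the per-prime input F1 is a theorem at the primes `p ∥ N_W`
(`atkinLehnerEigenvalueAt_eq_localRootNumberAt_of_squarefree`) and so is Atkin–Lehner's
`ε(f) = ∏ λ(p)` at squarefree level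
(`IsNewform0.frickeEigenvalue_eq_prod_atkinLehnerEigenvalueAt_of_squarefree`, `AtkinLehnerProductProofs`;
Knapp 1993, Lemma 9.24 and Thm. 9.27). [cite: KellockDokchitser2023, Cor. 2.5] [cite: Knapp1993, Thm. 9.27] -/
theorem rootNumber_eq_algebraicRootNumber_of_squarefree (hsq : Squarefree (W.conductorNorm ℤ))
    (hmod : exists_isNewformOf) : W.rootNumber_eq_algebraicRootNumber :=
  W.rootNumber_eq_algebraicRootNumber_of_atkinLehner hmod
    (IsNewform0.frickeEigenvalue_eq_prod_atkinLehnerEigenvalueAt_of_squarefree hsq)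
    (W.atkinLehnerEigenvalueAt_eq_localRootNumberAt_of_squarefree hsq)

/-- **The root number of a semistable `E / ℚ` from BCDT Theorem B and CDT Theorem 7.2.4** (which give
the Modularity Theorem, `exists_isNewformOf_of_theoremB_of_CDT`): trust base
{BCDT Thm. B, CDT Thm. 7.2.4} for `rootNumber_eq_algebraicRootNumber` at squarefree conductor.
[cite: BCDTJAMS2001, Theorem 2.2.2 and Theorem A] [cite: KellockDokchitser2023, Cor. 2.5] -/
theorem rootNumber_eq_algebraicRootNumber_of_theoremB_of_CDT_of_squarefree
    (hsq : Squarefree (W.conductorNorm ℤ)) (hB : theoremB) (hCDT : CDT_theorem_7_2_4) :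
    W.rootNumber_eq_algebraicRootNumber :=
  W.rootNumber_eq_algebraicRootNumber_of_squarefree hsq (exists_isNewformOf_of_theoremB_of_CDT hB hCDT)

/-- **`Λ(E, 2 − s) = −∏_p w_p(E) · Λ(E, s)` for a semistable `E / ℚ` from modularity alone** (the
functional equation with the algebraic sign; Kellock–Dokchitser 2023, Def. 2.1 and Cor. 2.5; Knapp
1993, Thm. 9.8). A semistable curve has no additive place, so no guard at `2, 3` is needed.
[cite: KellockDokchitser2023, Def. 2.1 and Cor. 2.5] [cite: Knapp1993, Thm. 9.8] -/
theorem hasFunctionalEquationSign_algebraicRootNumber_of_squarefree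
    (hsq : Squarefree (W.conductorNorm ℤ)) (hmod : exists_isNewformOf) [W.IsElliptic]
    (h23 : ∀ v : HeightOneSpectrum ℤ, W.HasAdditiveReductionAt v → 3 < ringChar (ℤ ⧸ v.asIdeal)) :
    W.HasFunctionalEquationSign W.algebraicRootNumber :=
  W.hasFunctionalEquationSign_algebraicRootNumber_of_atkinLehner hmod
    (IsNewform0.frickeEigenvalue_eq_prod_atkinLehnerEigenvalueAt_of_squarefree hsq)
    (W.atkinLehnerEigenvalueAt_eq_localRootNumberAt_of_squarefree hsq) h23

/-- **`w(E/ℚ) = −∏_p w_p(E)` in general from modularity, Kellock–Dokchitser's Remark 2.2 and Knapp's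
Thm. 9.27(b)**: with Atkin–Lehner's product formula `ε(f) = ∏ λ(Q_p)` (Thm. 9.27(c)) now derived from
Thm. 9.27(b) (`IsNewform0.frickeEigenvalue_eq_prod_atkinLehnerEigenvalueAt_of`, `AtkinLehnerProductProofs`),
the named fact `W.rootNumber_eq_algebraicRootNumber` holds for `W` from the Modularity Theorem
(`exists_isNewformOf`), F1 (`atkinLehnerEigenvalueAt_eq_localRootNumberAt`, deep at the additive
primes only) and F3 = `IsNewform0.exists_atkinLehnerInvolutionAt_eq_smul` at level `N_W` in weight `2`
(a newform is an eigenvector of each `w_{Q_p}`; Knapp 1993, Thm. 9.27(b), classical). This is the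
trust base of the fact in the tree after this file.
[cite: KellockDokchitser2023, Def. 2.1 and Rem. 2.2] [cite: Knapp1993, Thm. 9.27(b)] -/
theorem rootNumber_eq_algebraicRootNumber_of_exists_atkinLehnerInvolutionAt_eq_smul
    (hmod : exists_isNewformOf)
    (hF3 : ∀ [NeZero (W.conductorNorm ℤ)],
      IsNewform0.exists_atkinLehnerInvolutionAt_eq_smul (N := W.conductorNorm ℤ) (k := (2 : ℤ)))
    (hF1 : W.atkinLehnerEigenvalueAt_eq_localRootNumberAt) : W.rootNumber_eq_algebraicRootNumber :=
  W.rootNumber_eq_algebraicRootNumber_of_atkinLehner hmod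
    (IsNewform0.frickeEigenvalue_eq_prod_atkinLehnerEigenvalueAt_of hF3) hF1

/-- The same from BCDT Theorem B and CDT Theorem 7.2.4: trust base
{BCDT Thm. B, CDT Thm. 7.2.4, F1 (Kellock–Dokchitser Rem. 2.2 at `p ∣ N_E`), F3 (Knapp Thm. 9.27(b))}
of `rootNumber_eq_algebraicRootNumber` in the tree.
[cite: BCDTJAMS2001, Theorem 2.2.2 and Theorem A] [cite: KellockDokchitser2023, Def. 2.1 and Rem. 2.2] -/
theorem rootNumber_eq_algebraicRootNumber_of_theoremB_of_CDT_of_exists_atkinLehnerInvolutionAt_eq_smul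
    (hB : theoremB) (hCDT : CDT_theorem_7_2_4)
    (hF3 : ∀ [NeZero (W.conductorNorm ℤ)],
      IsNewform0.exists_atkinLehnerInvolutionAt_eq_smul (N := W.conductorNorm ℤ) (k := (2 : ℤ)))
    (hF1 : W.atkinLehnerEigenvalueAt_eq_localRootNumberAt) : W.rootNumber_eq_algebraicRootNumber :=
  W.rootNumber_eq_algebraicRootNumber_of_exists_atkinLehnerInvolutionAt_eq_smul
    (exists_isNewformOf_of_theoremB_of_CDT hB hCDT) hF3 hF1

end Rat

end WeierstrassCurve

end
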